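import Mathlib

/-!
# Subfield cell `GL₂(𝔽₂₅) ⊃ SL₂(𝔽₅)` — every embedding `SL₂(𝔽₅) ↪ GL₂(𝔽₂₅)` is the standard one up to conjugacy
# (crux `LevelGradedCohnUmans.GradedDesignFamily`, stmt-MatrixMultiplication-7610; negative side, line
# `quadratic-extension-level-one-cell`, stub S3 `stub_subfieldCell`, cell `q = 5`; gen 14, unit b2b-lgcu-subfield-g14)

HONEST FRAMING.  A finite group-theoretic CLASSIFICATION used only to remove the "standard model" caveat from the
`q = 5` cell theorems (`SubfieldCellTwentyfiveAny.lean`): it decides nothing about the asymptotic stub or the summit.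
VALUE = THEOREM (finite, exhaustive), NOT summit progress.

THEOREM (`embedding_conj`).  For every injective homomorphism `φ : SL₂(𝔽₅) →* GL₂(𝔽₂₅)` (models `ZMod 5` and
`QuadraticAlgebra (ZMod 5) 2 0`, `i² = 2`) there is `g ∈ GL₂(𝔽₂₅)` with `φ(x) = g · mapGL(x) · g⁻¹` for all `x`
(stated with a bijective twist `τ = id` of `SL₂(𝔽₅)` for uniformity with the `q = 4` file `SubfieldCellSixteenEmbedding`).
PROOF (elementary, exhaustive where convenient).  `SL₂(𝔽₅) ≅ 2I = ⟨a, b ∣ a² = b³ = (ab)⁵⟩` with `a = !![0,-1;1,0]`,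
`b = !![0,-1;1,1]` (`a² = b³ = (ab)⁵ = -1`; the 120 words `words120` exhaust the group, so a homomorphism is determined by
the images of `a, b`).  Both generators are commutators (`comm_a`, `comm_b`), so their images have determinant `1`
(`𝔽₂₅ˣ` is abelian).  Involutions of `SL₂(𝔽₂₅)` are `±1` (`invol_pm`, exhaustive), hence `φ(-1) = -1`.  Every `B` with
`det B = 1`, `B³ = -1`, `B ≠ -1` is conjugate to `bK = mapGL b` by an explicit `[v ∣ Bv]` (`fact_conjB`, exhaustive over
`M₂(𝔽₂₅)`), and after this normalisation every `A` with `A² = -1`, `(A·bK)⁵ = -1` is conjugate to `aK = mapGL a` by an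
element `x + y·bK` of the centraliser of `bK` (`fact_conjA`, exhaustive; `24` such `A`, one orbit).  Offline cross-check:
`code/b2b-lgcu-subfield-g14/emb5b.py` (651 = 650 + 1 matrices `B`, 24 matrices `A`, 0 failures).
Axioms: `propext`, `Classical.choice`, `Quot.sound`, `Lean.ofReduceBool` (`native_decide`).
-/

set_option linter.dupNamespace false
set_option linter.style.longLine false
set_option linter.style.setOption false

namespace Summit.MatrixMultiplication.MatrixMultiplication.Theorems.GradedDesignFamily.Negative.SubfieldTwentyfive

open Matrix

/-- `5` is prime. -/
instance instFactP5 : Fact (Nat.Prime 5) := ⟨by norm_num⟩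

/-- `𝔽₅`. -/
abbrev K5 : Type := ZMod 5

/-- `𝔽₂₅ = 𝔽₅[i]/(i² = 2)` (the model of the `q = 5` cell files). -/
abbrev K25 : Type := QuadraticAlgebra (ZMod 5) 2 0

/-- `X² - 2` is irreducible over `𝔽₅`, so `K25` is a field. -/
instance instFactK25 : Fact (∀ r : ZMod 5, r ^ 2 ≠ 2 + 0 * r) := ⟨by decide⟩

/-- `K25` is finite (via `K25 ≃ 𝔽₅ × 𝔽₅`). -/
instance instFintypeK25 : Fintype K25 :=
  Fintype.ofEquiv _ (QuadraticAlgebra.equivProd (2 : ZMod 5) 0).symm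

/-- `|𝔽₅| = 5`. -/
theorem card_K5 : Fintype.card K5 = 5 := rfl

/-- `|𝔽₂₅| = 25`. -/
theorem card_K25 : Fintype.card K25 = 25 := rfl

/-- `2 × 2` matrices over `𝔽₂₅`. -/
abbrev Mat : Type := Matrix (Fin 2) (Fin 2) K25
/-- `H = SL₂(𝔽₅)`. -/
abbrev SL5 : Type := Matrix.SpecialLinearGroup (Fin 2) K5

/-! ### Generators and words -/

/-- `a = !![0, -1; 1, 0]` (order `4`). -/
def aSL : SL5 := ⟨!![0, -1; 1, 0], by rw [Matrix.det_fin_two_of]; decide⟩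
/-- `b = !![0, -1; 1, 1]` (order `6`). -/
def bSL : SL5 := ⟨!![0, -1; 1, 1], by rw [Matrix.det_fin_two_of]; decide⟩
/-- `-1 ∈ SL₂(𝔽₅)`. -/
def mSL : SL5 := ⟨!![-1, 0; 0, -1], by rw [Matrix.det_fin_two_of]; decide⟩
/-- commutator data: `a = [xa, ya]`. -/
def xaSL : SL5 := ⟨!![0, 2; 2, 0], by rw [Matrix.det_fin_two_of]; decide⟩
/-- commutator data: `a = [xa, ya]`. -/
def yaSL : SL5 := ⟨!![1, 1; 2, 3], by rw [Matrix.det_fin_two_of]; decide⟩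
/-- commutator data: `b = [xb, yb]`. -/
def xbSL : SL5 := ⟨!![0, 1; 4, 3], by rw [Matrix.det_fin_two_of]; decide⟩
/-- commutator data: `b = [xb, yb]`. -/
def ybSL : SL5 := ⟨!![0, 2; 2, 2], by rw [Matrix.det_fin_two_of]; decide⟩

/-- `aK = mapGL a` as a matrix over `𝔽₂₅`. -/
def aK : Mat := !![0, -1; 1, 0]
/-- `bK = mapGL b` as a matrix over `𝔽₂₅`. -/
def bK : Mat := !![0, -1; 1, 1]

/-- The standard embedding on matrices. -/
def phiM (h : SL5) : Mat := fun i j => ⟨(h : Matrix (Fin 2) (Fin 2) K5) i j, 0⟩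

/-- `phiM` is the standard embedding `mapGL`, as matrices. -/
theorem phiM_eq (h : SL5) :
    phiM h = ((Matrix.SpecialLinearGroup.mapGL K25 h : GL (Fin 2) K25) : Mat) := by
  ext i j <;> simp [phiM, QuadraticAlgebra.algebraMap_eq]

/-- `mapGL a = aK`. -/
theorem mapGL_aSL : ((Matrix.SpecialLinearGroup.mapGL K25 aSL : GL (Fin 2) K25) : Mat) = aK := by
  rw [← phiM_eq]; native_decide

/-- `mapGL b = bK`. -/
theorem mapGL_bSL : ((Matrix.SpecialLinearGroup.mapGL K25 bSL : GL (Fin 2) K25) : Mat) = bK := by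
  rw [← phiM_eq]; native_decide

/-- `mapGL (-1) = -1`. -/
theorem mapGL_mSL : ((Matrix.SpecialLinearGroup.mapGL K25 mSL : GL (Fin 2) K25) : Mat) = -1 := by
  rw [← phiM_eq]; native_decide

/-- Evaluate a word (`false ↦ x`, `true ↦ y`). -/
def evalW {M : Type} [Monoid M] (x y : M) : List Bool → M
  | [] => 1
  | c :: w => (if c then y else x) * evalW x y w

/-- Words in `a, b` for the 120 elements of `SL₂(𝔽₅)` (breadth first). -/
def words120 : List (List Bool) :=
  [[], [false], [true], [false, false], [false, true], [true, false], [true, true], [false, false, false], [false, false, true], [false, true, false],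
   [false, true, true], [true, false, true], [true, true, false], [false, false, false, true], [false, false, true, false], [false, false, true, true],
   [false, true, false, true], [false, true, true, false], [true, false, true, false], [true, false, true, true], [true, true, false, true],
   [false, false, false, true, false], [false, false, false, true, true], [false, false, true, false, true], [false, false, true, true, false],
   [false, true, false, true, false], [false, true, false, true, true], [false, true, true, false, true], [true, false, true, false, true],
   [true, false, true, true, false], [true, true, false, true, false], [true, true, false, true, true], [false, false, false, true, false, true],
   [false, false, false, true, true, false], [false, false, true, false, true, false], [false, false, true, false, true, true],
   [false, false, true, true, false, true], [false, true, false, true, false, true], [false, true, false, true, true, false],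
   [false, true, true, false, true, false], [false, true, true, false, true, true], [true, false, true, false, true, false],
   [true, false, true, false, true, true], [true, false, true, true, false, true], [true, true, false, true, false, true],
   [true, true, false, true, true, false], [false, false, false, true, false, true, false], [false, false, false, true, false, true, true],
   [false, false, false, true, true, false, true], [false, false, true, false, true, false, true], [false, false, true, false, true, true, false],
   [false, false, true, true, false, true, false], [false, false, true, true, false, true, true], [false, true, false, true, false, true, true],
   [false, true, false, true, true, false, true], [false, true, true, false, true, false, true], [true, false, true, false, true, true, false],
   [true, false, true, true, false, true, false], [true, false, true, true, false, true, true], [true, true, false, true, false, true, false],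
   [true, true, false, true, false, true, true], [true, true, false, true, true, false, true], [false, false, false, true, false, true, true, false],
   [false, false, false, true, true, false, true, false], [false, false, true, false, true, false, true, true],
   [false, false, true, false, true, true, false, true], [false, false, true, true, false, true, false, true],
   [false, true, false, true, false, true, true, false], [false, true, false, true, true, false, true, false],
   [false, true, false, true, true, false, true, true], [false, true, true, false, true, false, true, false],
   [false, true, true, false, true, false, true, true], [true, false, true, false, true, true, false, true],
   [true, false, true, true, false, true, false, true], [true, true, false, true, false, true, true, false],
   [true, true, false, true, true, false, true, false], [false, false, false, true, false, true, true, false, true],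
   [false, false, false, true, true, false, true, false, true], [false, false, true, false, true, false, true, true, false],
   [false, false, true, false, true, true, false, true, false], [false, false, true, true, false, true, false, true, true],
   [false, true, false, true, false, true, true, false, true], [false, true, false, true, true, false, true, false, true],
   [false, true, true, false, true, false, true, true, false], [true, false, true, false, true, true, false, true, false],
   [true, false, true, false, true, true, false, true, true], [true, false, true, true, false, true, false, true, false],
   [true, false, true, true, false, true, false, true, true], [true, true, false, true, false, true, true, false, true],
   [true, true, false, true, true, false, true, false, true], [false, false, false, true, false, true, true, false, true, false],
   [false, false, false, true, true, false, true, false, true, true], [false, false, true, false, true, false, true, true, false, true],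
   [false, false, true, false, true, true, false, true, false, true], [false, false, true, true, false, true, false, true, true, false],
   [false, true, false, true, false, true, true, false, true, false], [false, true, false, true, false, true, true, false, true, true],
   [false, true, false, true, true, false, true, false, true, false], [false, true, false, true, true, false, true, false, true, true],
   [false, true, true, false, true, false, true, true, false, true], [true, false, true, true, false, true, false, true, true, false],
   [true, true, false, true, false, true, true, false, true, false], [true, true, false, true, true, false, true, false, true, false],
   [false, false, false, true, false, true, true, false, true, false, true], [false, false, false, true, true, false, true, false, true, true, false],
   [false, false, true, false, true, false, true, true, false, true, false], [false, false, true, false, true, true, false, true, false, true, true],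
   [false, false, true, true, false, true, false, true, true, false, true], [false, true, false, true, true, false, true, false, true, true, false],
   [false, true, true, false, true, false, true, true, false, true, false], [true, false, true, true, false, true, false, true, true, false, true],
   [false, false, false, true, false, true, true, false, true, false, true, true],
   [false, false, false, true, true, false, true, false, true, true, false, true],
   [false, false, true, false, true, true, false, true, false, true, true, false],
   [false, false, true, true, false, true, false, true, true, false, true, false],
   [false, true, false, true, true, false, true, false, true, true, false, true],
   [true, false, true, true, false, true, false, true, true, false, true, false],
   [false, false, false, true, false, true, true, false, true, false, true, true, false],
   [false, false, false, true, true, false, true, false, true, true, false, true, false],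
   [false, false, true, false, true, true, false, true, false, true, true, false, true]]

/-- Every element of `SL₂(𝔽₅)` is one of the 120 words. -/
theorem sl5_words : ∀ h : SL5, ∃ w ∈ words120, evalW aSL bSL w = h := by native_decide

/-- Homomorphisms commute with word evaluation. -/
theorem map_evalW {M N : Type} [Monoid M] [Monoid N] (f : M →* N) (x y : M) (w : List Bool) :
    f (evalW x y w) = evalW (f x) (f y) w := by
  induction w with
  | nil => simp [evalW]
  | cons c w ih => cases c <;> simp [evalW, ih]

/-- Two homomorphisms out of `SL₂(𝔽₅)` that agree on `a` and `b` are equal. -/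
theorem hom_eq_of_ab {N : Type} [Monoid N] (f g : SL5 →* N) (ha : f aSL = g aSL)
    (hb : f bSL = g bSL) : f = g := by
  ext h
  obtain ⟨w, -, rfl⟩ := sl5_words h
  rw [map_evalW, map_evalW, ha, hb]

/-- The relations used: `a² = -1`, `b³ = -1`, `(ab)⁵ = -1`, `(-1)² = 1`, `-1 ≠ 1`, `b ≠ -1`, and the two
commutator identities `a·ya·xa = xa·ya`, `b·yb·xb = xb·yb`. -/
theorem gen_rels : aSL * aSL = mSL ∧ bSL * bSL * bSL = mSL ∧ (aSL * bSL) ^ 5 = mSL ∧ mSL * mSL = 1 ∧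
    mSL ≠ 1 ∧ bSL ≠ mSL ∧ aSL * yaSL * xaSL = xaSL * yaSL ∧ bSL * ybSL * xbSL = xbSL * ybSL := by
  native_decide

/-! ### Exhaustive facts over `M₂(𝔽₂₅)` -/

/-- `det`, written out. -/
def det2 (M : Mat) : K25 := M 0 0 * M 1 1 - M 0 1 * M 1 0

/-- `det2 = det`. -/
theorem det2_eq (M : Mat) : det2 M = M.det := by
  rw [Matrix.det_fin_two]; rfl

/-- The matrix with columns `v, w`. -/
def colsOf (v w : Fin 2 → K25) : Mat := !![v 0, w 0; v 1, w 1]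

/-- `x·1 + y·bK` (the centraliser of `bK`). -/
def linC (x y : K25) : Mat := !![x, -y; y, x + y]

set_option maxHeartbeats 4000000 in
set_option synthInstance.maxHeartbeats 2000000 in
set_option synthInstance.maxSize 1000000 in
/-- **Exhaustive fact:** an involution of `SL₂(𝔽₂₅)` is `±1`. -/
theorem invol_pm : ∀ X : Mat, det2 X = 1 → X * X = 1 → X = 1 ∨ X = -1 := by
  native_decide

set_option maxHeartbeats 4000000 in
set_option synthInstance.maxHeartbeats 2000000 in
set_option synthInstance.maxSize 1000000 in
/-- **Exhaustive fact:** every `B ∈ SL₂(𝔽₂₅)` with `B³ = -1` is `-1` or conjugate to `bK` by some `[v ∣ Bv]`,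
`v ∈ {e₁, e₂, e₁ + e₂}`. -/
theorem fact_conjB : ∀ B : Mat, det2 B = 1 → B * B * B = -1 → B = -1 ∨
    ∃ v ∈ [![(1 : K25), 0], ![0, 1], ![1, 1]],
      det2 (colsOf v (B *ᵥ v)) ≠ 0 ∧ colsOf v (B *ᵥ v) * bK = B * colsOf v (B *ᵥ v) := by
  native_decide

set_option maxHeartbeats 4000000 in
set_option synthInstance.maxHeartbeats 2000000 in
set_option synthInstance.maxSize 1000000 in
/-- **Exhaustive fact:** every `A` with `A² = -1` and `(A·bK)⁵ = -1` is conjugate to `aK` by an invertible element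
`x + y·bK` of the centraliser of `bK` (there are exactly `24` such `A`). -/
theorem fact_conjA : ∀ A : Mat, A * A = -1 → (A * bK) ^ 5 = -1 →
    ∃ x : K25, ∃ y : K25, det2 (linC x y) ≠ 0 ∧ linC x y * bK = bK * linC x y ∧ linC x y * aK = A * linC x y := by
  native_decide

/-! ### The classification -/

/-- From a matrix identity `g * x = y * g` with `g` invertible to `y = G * x * G⁻¹` in `GL₂`. -/
theorem conj_of_eq (G x y : GL (Fin 2) K25) (h : (G : Mat) * (x : Mat) = (y : Mat) * (G : Mat)) :
    y = G * x * G⁻¹ := by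
  have h' : G * x = y * G := Units.ext (by rw [Units.val_mul, Units.val_mul, h])
  rw [h', mul_inv_cancel_right]

/-- The image of a commutator-type element (`t·y·x = x·y`) has determinant `1` (`𝔽₂₅ˣ` is abelian). -/
theorem det2_of_comm (φ : SL5 →* GL (Fin 2) K25) (t x y : SL5) (h : t * y * x = x * y) :
    det2 ((φ t : GL (Fin 2) K25) : Mat) = 1 := by
  have hD : Matrix.GeneralLinearGroup.det (φ t) = 1 := by
    have h1 := congrArg (fun s : SL5 => Matrix.GeneralLinearGroup.det (φ s)) h
    simp only [map_mul] at h1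
    have h2 : Matrix.GeneralLinearGroup.det (φ t) *
        (Matrix.GeneralLinearGroup.det (φ y) * Matrix.GeneralLinearGroup.det (φ x)) =
        1 * (Matrix.GeneralLinearGroup.det (φ y) * Matrix.GeneralLinearGroup.det (φ x)) := by
      rw [one_mul, ← mul_assoc, h1, mul_comm]
    exact mul_right_cancel h2
  have hD' := congrArg (fun u : K25ˣ => (u : K25)) hD
  simp only [Matrix.GeneralLinearGroup.val_det_apply, Units.val_one] at hD'
  rw [det2_eq]
  exact hD'

/-- The image of `-1` under an injective `φ` is the matrix `-1`. -/
theorem map_mSL (φ : SL5 →* GL (Fin 2) K25) (hφ : Function.Injective φ) :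
    ((φ mSL : GL (Fin 2) K25) : Mat) = -1 := by
  obtain ⟨ha2, -, -, hm2, hm1, -, hca, -⟩ := gen_rels
  have hdetA : det2 ((φ aSL : GL (Fin 2) K25) : Mat) = 1 := det2_of_comm φ aSL xaSL yaSL hca
  have hdet : det2 ((φ mSL : GL (Fin 2) K25) : Mat) = 1 := by
    rw [← ha2, map_mul, Units.val_mul, det2_eq, Matrix.det_mul, ← det2_eq, hdetA, mul_one]
  have hsq : ((φ mSL : GL (Fin 2) K25) : Mat) * (φ mSL : GL (Fin 2) K25) = 1 := by
    rw [← Units.val_mul, ← map_mul, hm2, map_one, Units.val_one]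
  rcases invol_pm _ hdet hsq with h | h
  · exact absurd (hφ (by rw [map_one]; exact Units.ext h)) hm1
  · exact h

set_option maxHeartbeats 2000000 in
/-- **Every embedding `SL₂(𝔽₅) ↪ GL₂(𝔽₂₅)` is standard up to conjugacy** (`τ = id`). -/
theorem embedding_conj (φ : SL5 →* GL (Fin 2) K25) (hφ : Function.Injective φ) :
    ∃ g : GL (Fin 2) K25, ∃ τ : SL5 →* SL5, Function.Bijective τ ∧
      ∀ a : SL5, φ a = g * Matrix.SpecialLinearGroup.mapGL K25 (τ a) * g⁻¹ := by
  obtain ⟨ha2, hb3, hab, hm2, hm1, hbm, hca, hcb⟩ := gen_rels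
  have hval : ∀ (x : GL (Fin 2) K25) (n : ℕ), ((x ^ n : GL (Fin 2) K25) : Mat) = (x : Mat) ^ n :=
    fun x n => Units.val_pow_eq_pow_val x n
  -- step 1: conjugate `φ b` to `bK`
  set B := φ bSL with hBdef
  have hBdet : det2 (B : Mat) = 1 := det2_of_comm φ bSL xbSL ybSL hcb
  have hB3 : (B : Mat) * B * B = -1 := by
    rw [← map_mSL φ hφ, ← hb3, map_mul, map_mul, Units.val_mul, Units.val_mul]
  have hB1 : (B : Mat) ≠ -1 := by
    intro h
    apply hbm
    apply hφ
    exact Units.ext (by rw [map_mSL φ hφ]; exact h)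
  obtain ⟨v, -, hg₁, hg₁b⟩ := (fact_conjB (B : Mat) hBdet hB3).resolve_left hB1
  set g₁ : Mat := colsOf v ((B : Mat) *ᵥ v) with hg₁def
  let G₁ : GL (Fin 2) K25 := Matrix.GeneralLinearGroup.mkOfDetNeZero (g₁ : Mat) (by rw [← det2_eq]; exact hg₁)
  have hG₁ : (G₁ : Mat) = g₁ := rfl
  let φ₁ : SL5 →* GL (Fin 2) K25 := (MulAut.conj G₁⁻¹).toMonoidHom.comp φ
  have hφ₁ : ∀ a, φ₁ a = G₁⁻¹ * φ a * G₁ := by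
    intro a; simp [φ₁]
  have hφ₁inj : Function.Injective φ₁ := (MulAut.conj G₁⁻¹).injective.comp hφ
  have hφ₁b : φ₁ bSL = Matrix.SpecialLinearGroup.mapGL K25 bSL := by
    have h1 : B = G₁ * Matrix.SpecialLinearGroup.mapGL K25 bSL * G₁⁻¹ :=
      conj_of_eq G₁ _ _ (by rw [mapGL_bSL, hG₁]; exact hg₁b)
    rw [hφ₁, ← hBdef, h1]
    group
  -- step 2: the image of `a`
  set A := φ₁ aSL with hAdef
  have hA2 : (A : Mat) * A = -1 := by
    rw [← map_mSL φ₁ hφ₁inj, ← ha2, map_mul, Units.val_mul]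
  have hAb : ((A : Mat) * bK) ^ 5 = -1 := by
    rw [← mapGL_bSL, ← hφ₁b, ← Units.val_mul, ← hval, hAdef, ← map_mul, ← map_pow, hab, map_mSL φ₁ hφ₁inj]
  obtain ⟨x, y, hg₂, hg₂b, hg₂a⟩ := fact_conjA (A : Mat) hA2 hAb
  set g₂ : Mat := linC x y with hg₂def
  let G₂ : GL (Fin 2) K25 := Matrix.GeneralLinearGroup.mkOfDetNeZero (g₂ : Mat) (by rw [← det2_eq]; exact hg₂)
  have hG₂ : (G₂ : Mat) = g₂ := rfl
  have hbconj : φ₁ bSL = G₂ * Matrix.SpecialLinearGroup.mapGL K25 bSL * G₂⁻¹ := by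
    rw [hφ₁b]
    exact conj_of_eq G₂ _ _ (by rw [mapGL_bSL, hG₂]; exact hg₂b)
  -- step 3: comparison on generators (`τ = id`)
  let ψ : SL5 →* GL (Fin 2) K25 :=
    (MulAut.conj G₂).toMonoidHom.comp (Matrix.SpecialLinearGroup.mapGL K25)
  have hψ : ∀ a, ψ a = G₂ * Matrix.SpecialLinearGroup.mapGL K25 a * G₂⁻¹ := by
    intro a; simp [ψ, MulAut.conj_apply]
  have heq : φ₁ = ψ := by
    apply hom_eq_of_ab
    · rw [hψ, ← hAdef]
      exact conj_of_eq G₂ _ _ (by rw [hG₂, mapGL_aSL]; exact hg₂a)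
    · rw [hψ, hbconj]
  refine ⟨G₁ * G₂, MonoidHom.id _, Function.bijective_id, fun a => ?_⟩
  have h1 : φ a = G₁ * φ₁ a * G₁⁻¹ := by rw [hφ₁]; group
  rw [h1, heq, hψ, MonoidHom.id_apply]
  group

end Summit.MatrixMultiplication.MatrixMultiplication.Theorems.GradedDesignFamily.Negative.SubfieldTwentyfive
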